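import Summits.AtomisticToContinuum.Crystallization.Theorems.FreeSplittingCertificatesStrictSplittingRuleHcpShellMoments

/-!
# `StrictSplittingRule` (stmt-AtomisticToContinuum-12560): continuum symbols of the H12⋆ far lemma

Route `FreeSplittingCertificates`, crux r3 `StrictSplittingRule`, line `registered` (unit b2b-freesplit-B, gen 8).
The one analytic piece missing between the cell's finite certificates and a proof of the registered H12⋆
(`stub_coreJointCoercive`) is the FAR LEMMA (HOME CERT.md §14–§16, FAR-LEMMA-SPEC.md): on co-rotated fields `v` vanishing
near the reference site, the receipts `Rec(v) = Σ_x ω(‖y_x‖) Σ_s ⟪y_s, v_{x_s} − v_x⟫²` of the `r⁻⁶` import family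
(`ω(r) = c₆ r⁻⁶`) must dominate the readout demand of the landed line truss `Read(v) = Σ_q Σ_{t ∈ Y₁} β ½‖v_{q+t} − v_q‖²`
(`β → λ_t r⁻⁶/12`) plus the bare radial deficit `Σ_x [(7/4)‖y_x‖⁻⁸⟪ŷ_x, v_x⟫² − ¼‖y_x‖⁻⁸‖v_x − ⟪ŷ_x,v_x⟫ŷ_x‖²]`.
All three forms are homogeneous of degree `−6` under dilations, so their scale-invariant continuum limits are diagonalised
by the Mellin transform in `r` (exponent `s = 5/2 + iτ`) times vector spherical harmonics (degree `ℓ`, `L = ℓ(ℓ+1)`):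
per `(L, τ)` the toroidal sector is a scalar and the spheroidal sector a Hermitian `2 × 2` pencil, with sphere-integrated
densities (gen-7 `symbols.py`, brute-force checked by `check_cartesian.py`)
`|∇v|²: |U′|² + L(|V′|²+|W′|²) + r⁻²[L|U−V|² + L|W|² + 2|U|² + L(L−1)(|V|²+|W|²) − 2L Re(U V̄)]`,
`|e(v)|²: |U′|² + (L/2)(|V′ + (U−V)/r|² + |W′ − W/r|²) + r⁻²[2|U|² + L(L−1)|V|² + (L(L−2)/2)|W|² − 2L Re(U V̄)]`,
`(div v)²: |U′ + (2U − LV)/r|²`, `‖v‖² ↦ |U|² + L(|V|²+|W|²)`, `⟪x̂,v⟫² ↦ |U|²`.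

This file records, as kernel-checked algebra, the three finite facts the continuum analysis rests on:

* §1 `hcpShell_strain_form` — the RECEIPTS SYMBOL: the quartic shell form `Σ_{s ∈ hcpStarIdx} ⟪y_s, E y_s⟫²` of the relaxed
  hcp first shell (`y_s = hcpSite a h s`) in closed form for every symmetric `E` (transversely isotropic:
  `(3/2)a⁴(e₀₀+e₁₁)² + (5/6)a⁴(e₀₀−e₁₁)² + (10/3)a⁴e₀₁² + (1/6)(a²(e₀₀+e₁₁) + 6h²e₂₂)² + 4a²h²(e₀₂²+e₁₂²)`), and
  `hcpShell_strain_form_ge` — `≥ min((5/3)a⁴, 2a²h², 3h⁴)·‖E‖²_F` for all `a, h` (sharp at the ideal ratio: `(4/3)a⁴`); at the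
  ideal ratio `h² = 2a²/3` the form is sandwiched between `5/6` and `5/4` times the isotropic twelve-design form
  `(4/5)a⁴((tr E)² + 2‖E‖²_F)` (`hcpShell_strain_form_ideal_ge/le`);
* §2 `kornSymbolT_le`, `kornSymbolS_le`, `kornSymbolT_sharp` — the continuum sharp constant of the PINNED EXTERIOR WEIGHTED KORN
  inequality of FAR-LEMMA-SPEC §5 (h) in the isotropic twelve-design model, `Σ_s |ŝ·∇v|² = 4|∇v|²` over
  `Σ_s (ŝ·e·ŝ)² = (4/5)((div v)² + 2|e|²)`: the symbol pencil is bounded by `55/3` in every sector and `55/3` is attained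
  (toroidal `ℓ = 1`, `τ = 0`: the differential rotation `r^{5/2} Ω × x̂`) — lattice extrapolation of gen 6: `K_w(∞) ≈ 19–23`
  in units `a₀⁻²`, `55/3·a₀⁻² = 19.43`;
* §3 `farSymbolT_le`, `farSymbolS_le` — the FAR PENCIL itself: readout `(1/24)|∇v|²` plus bare `(7/4)⟪x̂,v⟫² − ¼(‖v‖² − ⟪x̂,v⟫²)`
  (weights `r⁻⁶`, `r⁻⁸`) is at most `(3/40)·(4/5)((div)² + 2|e|²)` symbol-wise in every sector (numerical sup `0.07240`, spheroidal
  `ℓ = 1`, `τ = 0`), i.e. in the continuum limit the far form of the compact table's family `ω = (29/8)r⁻⁶` (CERT §14) is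
  positive with `t*_cont ≤ (3/40)/((29/8)a₀⁴) = 0.0233` (lattice, inner radius `3.05a`: `t* = 0.054`, CERT §15) — ALL polynomial
  coefficients of the certificate are positive, so §3 holds for every real `L ≥ 0`.

HONEST FRAMING.  These are statements about explicit polynomials (the symbols); the analytic frame that makes them the sharp
constants of the lattice far lemma (Plancherel in `log r`, completeness of vector spherical harmonics, lattice-to-continuum
transfer with the `O(a/r)` corrections of `β`, `ω`, and the bare form) is NOT formalised here.  VALUE = kernel-checked bricks /
a decidable certificate of the continuum budget of the far lemma — NOT a proof of H12⋆, NOT summit progress. [folklore]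
-/

noncomputable section

namespace Summit.AtomisticToContinuum.Crystallization.Theorems.StrictSplittingRuleBirth

open scoped BigOperators
open Literature.MathematicalPhysics.StatisticalMechanics
open Summit.AtomisticToContinuum.Crystallization.Theorems.PalmUnimodularRigidity.LayeredLawsSelectHcp

/-! ## §1 The receipts symbol: the quartic strain form of the hcp shell -/

/-- **The shell strain form in closed form**: for every symmetric `E = (e_ij)` and all `a, h`,
`Σ_{s ∈ shell} ⟪y_s, E y_s⟫² = (3/2)a⁴(e₀₀+e₁₁)² + (5/6)a⁴(e₀₀−e₁₁)² + (10/3)a⁴e₀₁² + (1/6)(a²(e₀₀+e₁₁) + 6h²e₂₂)² + 4a²h²(e₀₂²+e₁₂²)`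
(rank one `E = z ⊗ z`: `hcpShell_fourth_moment`). [folklore] -/
theorem hcpShell_strain_form (a h e₀₀ e₁₁ e₂₂ e₀₁ e₀₂ e₁₂ : ℝ) :
    ∑ s ∈ hcpStarIdx,
        (e₀₀ * hcpSite a h s 0 ^ 2 + e₁₁ * hcpSite a h s 1 ^ 2 + e₂₂ * hcpSite a h s 2 ^ 2 +
            2 * e₀₁ * (hcpSite a h s 0 * hcpSite a h s 1) + 2 * e₀₂ * (hcpSite a h s 0 * hcpSite a h s 2) +
          2 * e₁₂ * (hcpSite a h s 1 * hcpSite a h s 2)) ^ 2 =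
      3 / 2 * a ^ 4 * (e₀₀ + e₁₁) ^ 2 + 5 / 6 * a ^ 4 * (e₀₀ - e₁₁) ^ 2 + 10 / 3 * a ^ 4 * e₀₁ ^ 2 +
          1 / 6 * (a ^ 2 * (e₀₀ + e₁₁) + 6 * h ^ 2 * e₂₂) ^ 2 +
        4 * a ^ 2 * h ^ 2 * (e₀₂ ^ 2 + e₁₂ ^ 2) := by
  obtain ⟨l0, l1, lm1⟩ := hcpShell_labels
  have h3 : (√3 : ℝ) ^ 2 = 3 := Real.sq_sqrt (by norm_num)
  have h9 : (√3 : ℝ) ^ 4 = 9 := by rw [show (4 : ℕ) = 2 * 2 by norm_num, pow_mul, h3]; norm_num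
  rw [hcpShell_sum_expand]
  simp only [hcpSite_apply_zero, hcpSite_apply_one, hcpSite_apply_two, l0, l1, lm1]
  push_cast
  ring_nf
  rw [h3, h9]
  ring

/-- **Isotropic lower bound of the shell strain form**: `Σ_s ⟪y_s, E y_s⟫² ≥ min((5/3)a⁴, 2a²h², 3h⁴)·‖E‖²_F` for every
symmetric `E` (`‖E‖²_F = Σ e_ii² + 2Σ_{i<j} e_ij²`); at the ideal ratio `h² = 2a²/3` the constant is `(4/3)a⁴` and is attained
on the out-of-plane shears.  The continuum receipts of an `r⁻⁶` import family therefore dominate `(4/3)a⁴·c₆ ∫ r⁻⁶|e(v)|²`. [folklore] -/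
theorem hcpShell_strain_form_ge (a h e₀₀ e₁₁ e₂₂ e₀₁ e₀₂ e₁₂ : ℝ) :
    min (min (5 / 3 * a ^ 4) (2 * a ^ 2 * h ^ 2)) (3 * h ^ 4) *
        (e₀₀ ^ 2 + e₁₁ ^ 2 + e₂₂ ^ 2 + 2 * e₀₁ ^ 2 + 2 * e₀₂ ^ 2 + 2 * e₁₂ ^ 2) ≤
      ∑ s ∈ hcpStarIdx,
        (e₀₀ * hcpSite a h s 0 ^ 2 + e₁₁ * hcpSite a h s 1 ^ 2 + e₂₂ * hcpSite a h s 2 ^ 2 +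
            2 * e₀₁ * (hcpSite a h s 0 * hcpSite a h s 1) + 2 * e₀₂ * (hcpSite a h s 0 * hcpSite a h s 2) +
          2 * e₁₂ * (hcpSite a h s 1 * hcpSite a h s 2)) ^ 2 := by
  rw [hcpShell_strain_form]
  set μ := min (min (5 / 3 * a ^ 4) (2 * a ^ 2 * h ^ 2)) (3 * h ^ 4) with hμ
  have hμ1 : μ ≤ 5 / 3 * a ^ 4 := (min_le_left _ _).trans (min_le_left _ _)
  have hμ2 : μ ≤ 2 * a ^ 2 * h ^ 2 := (min_le_left _ _).trans (min_le_right _ _)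
  have hμ3 : μ ≤ 3 * h ^ 4 := min_le_right _ _
  -- blockwise sums of squares: deviator `e₀₀ − e₁₁`, `e₀₁`; shears `e₀₂`, `e₁₂`; the `(e₀₀ + e₁₁, e₂₂)` block via
  -- `(2/3)(x + y)² = (1/3)(x + 2y)² + (1/3)x² − (2/3)y²`, `x = 3h²e₂₂`, `y = a²(e₀₀+e₁₁)/2`.
  nlinarith [mul_nonneg (sub_nonneg.2 hμ1) (sq_nonneg (e₀₀ - e₁₁)), mul_nonneg (sub_nonneg.2 hμ1) (sq_nonneg e₀₁),
    mul_nonneg (sub_nonneg.2 hμ1) (sq_nonneg (e₀₀ + e₁₁)), mul_nonneg (sub_nonneg.2 hμ2) (sq_nonneg e₀₂),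
    mul_nonneg (sub_nonneg.2 hμ2) (sq_nonneg e₁₂), mul_nonneg (sub_nonneg.2 hμ3) (sq_nonneg e₂₂),
    sq_nonneg (3 * h ^ 2 * e₂₂ + a ^ 2 * (e₀₀ + e₁₁)), sq_nonneg a, sq_nonneg h,
    mul_nonneg (sq_nonneg a) (sq_nonneg (e₀₀ + e₁₁)), sq_nonneg (a ^ 2 * (e₀₀ + e₁₁))]

/-- **Ideal ratio, lower side of the isotropic sandwich**: at `h² = 2a²/3` the shell strain form is at least `5/6` of the
isotropic twelve-design form `(4/5)a⁴((tr E)² + 2‖E‖²_F)` (equality on the out-of-plane shears). [folklore] -/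
theorem hcpShell_strain_form_ideal_ge (a h e₀₀ e₁₁ e₂₂ e₀₁ e₀₂ e₁₂ : ℝ) (hid : h ^ 2 = 2 / 3 * a ^ 2) :
    5 / 6 * (4 / 5 * a ^ 4 * ((e₀₀ + e₁₁ + e₂₂) ^ 2 +
        2 * (e₀₀ ^ 2 + e₁₁ ^ 2 + e₂₂ ^ 2 + 2 * e₀₁ ^ 2 + 2 * e₀₂ ^ 2 + 2 * e₁₂ ^ 2))) ≤
      ∑ s ∈ hcpStarIdx,
        (e₀₀ * hcpSite a h s 0 ^ 2 + e₁₁ * hcpSite a h s 1 ^ 2 + e₂₂ * hcpSite a h s 2 ^ 2 +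
            2 * e₀₁ * (hcpSite a h s 0 * hcpSite a h s 1) + 2 * e₀₂ * (hcpSite a h s 0 * hcpSite a h s 2) +
          2 * e₁₂ * (hcpSite a h s 1 * hcpSite a h s 2)) ^ 2 := by
  rw [hcpShell_strain_form]
  have h4 : h ^ 4 = 4 / 9 * a ^ 4 := by rw [show (4 : ℕ) = 2 * 2 by norm_num, pow_mul, hid]; ring
  have e1 : 4 * a ^ 2 * h ^ 2 * (e₀₂ ^ 2 + e₁₂ ^ 2) = 8 / 3 * a ^ 4 * (e₀₂ ^ 2 + e₁₂ ^ 2) := by rw [hid]; ring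
  have e2 : 1 / 6 * (a ^ 2 * (e₀₀ + e₁₁) + 6 * h ^ 2 * e₂₂) ^ 2 =
      1 / 6 * a ^ 4 * ((e₀₀ + e₁₁) + 4 * e₂₂) ^ 2 := by rw [hid]; ring
  rw [e1, e2]
  nlinarith [sq_nonneg (e₀₀ - e₁₁), sq_nonneg e₀₁, sq_nonneg (e₀₀ + e₁₁ - e₂₂), sq_nonneg a,
    mul_nonneg (sq_nonneg (a ^ 2)) (sq_nonneg (e₀₀ - e₁₁)), mul_nonneg (sq_nonneg (a ^ 2)) (sq_nonneg e₀₁),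
    mul_nonneg (sq_nonneg (a ^ 2)) (sq_nonneg (e₀₀ + e₁₁ - e₂₂))]

/-- **Ideal ratio, upper side of the isotropic sandwich**: at `h² = 2a²/3` the shell strain form is at most `5/4` of the
isotropic twelve-design form (equality on the trace-type block). [folklore] -/
theorem hcpShell_strain_form_ideal_le (a h e₀₀ e₁₁ e₂₂ e₀₁ e₀₂ e₁₂ : ℝ) (hid : h ^ 2 = 2 / 3 * a ^ 2) :
    ∑ s ∈ hcpStarIdx,
        (e₀₀ * hcpSite a h s 0 ^ 2 + e₁₁ * hcpSite a h s 1 ^ 2 + e₂₂ * hcpSite a h s 2 ^ 2 +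
            2 * e₀₁ * (hcpSite a h s 0 * hcpSite a h s 1) + 2 * e₀₂ * (hcpSite a h s 0 * hcpSite a h s 2) +
          2 * e₁₂ * (hcpSite a h s 1 * hcpSite a h s 2)) ^ 2 ≤
      5 / 4 * (4 / 5 * a ^ 4 * ((e₀₀ + e₁₁ + e₂₂) ^ 2 +
        2 * (e₀₀ ^ 2 + e₁₁ ^ 2 + e₂₂ ^ 2 + 2 * e₀₁ ^ 2 + 2 * e₀₂ ^ 2 + 2 * e₁₂ ^ 2))) := by
  rw [hcpShell_strain_form]
  have e1 : 4 * a ^ 2 * h ^ 2 * (e₀₂ ^ 2 + e₁₂ ^ 2) = 8 / 3 * a ^ 4 * (e₀₂ ^ 2 + e₁₂ ^ 2) := by rw [hid]; ring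
  have e2 : 1 / 6 * (a ^ 2 * (e₀₀ + e₁₁) + 6 * h ^ 2 * e₂₂) ^ 2 =
      1 / 6 * a ^ 4 * ((e₀₀ + e₁₁) + 4 * e₂₂) ^ 2 := by rw [hid]; ring
  rw [e1, e2]
  nlinarith [sq_nonneg (e₀₀ - e₁₁), sq_nonneg e₀₁, sq_nonneg e₀₂, sq_nonneg e₁₂, sq_nonneg (2 * (e₀₀ + e₁₁) + e₂₂),
    mul_nonneg (sq_nonneg (a ^ 2)) (sq_nonneg (e₀₀ - e₁₁)), mul_nonneg (sq_nonneg (a ^ 2)) (sq_nonneg e₀₁),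
    mul_nonneg (sq_nonneg (a ^ 2)) (sq_nonneg e₀₂), mul_nonneg (sq_nonneg (a ^ 2)) (sq_nonneg e₁₂),
    mul_nonneg (sq_nonneg (a ^ 2)) (sq_nonneg (2 * (e₀₀ + e₁₁) + e₂₂))]

/-! ## §2 The continuum constant of the pinned exterior weighted Korn inequality: `55/3`

Mellin exponent `s = 5/2 + iτ`: `|s|² = 25/4 + τ²`, `|s − 1|² = 9/4 + τ²`, `|s + 2|² = 81/4 + τ²`, `|s − 3|² = 1/4 + τ²`.
Toroidal sector (amplitude `w`): `|∇v|² ↦ L(|s|² + L)|w|²`, `|e|² ↦ (L/2)(|s−1|² + L − 2)|w|²`, `div ↦ 0`.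
Spheroidal sector (amplitudes `u, v ∈ ℂ`, written `u = u₁ + iu₂`, `v = v₁ + iv₂`; a Hermitian form
`a|u|² + c|v|² + 2 Re(b ū v)` reads `a(u₁²+u₂²) + c(v₁²+v₂²) + 2(b_re(u₁v₁+u₂v₂) − b_im(u₁v₂−u₂v₁))`):
`|∇v|²: a = |s|²+L+2, b = −2L, c = L(|s|²+L)`; `|e|²: a = |s|²+2+L/2, b = L(s−3)/2, c = L(|s−1|²/2+L−1)`;
`(div)²: a = |s+2|², b = −(s̄+2)L, c = L²`.  The Korn pencil of the isotropic twelve-design model is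
`4|∇v|²` over `(4/5)((div)² + 2|e|²)`, i.e. `5|∇v|²` over `(div)² + 2|e|²`. -/

/-- **Korn symbol, toroidal sector**: `5·L(|s|²+L) ≤ (55/3)·L(|s−1|²+L−2)` for `L = ℓ(ℓ+1) ≥ 2`, i.e.
`5(25/4 + τ² + L) ≤ (55/3)(1/4 + τ² + L)` — equivalent to `τ² + L ≥ 2`. [folklore] -/
theorem kornSymbolT_le (L τ : ℝ) (hL : 2 ≤ L) :
    5 * (L * (25 / 4 + τ ^ 2 + L)) ≤ 55 / 3 * (2 * (L / 2 * (9 / 4 + τ ^ 2 + L - 2))) := by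
  nlinarith [sq_nonneg τ, mul_nonneg (by linarith : (0:ℝ) ≤ L) (sq_nonneg τ),
    mul_nonneg (by linarith : (0:ℝ) ≤ L) (by linarith : (0:ℝ) ≤ L - 2)]

/-- **Sharpness**: equality at `ℓ = 1` (`L = 2`), `τ = 0` — the differential rotation `v = r^{5/2} Ω × x̂` realises `55/3`. [folklore] -/
theorem kornSymbolT_sharp :
    5 * ((2 : ℝ) * (25 / 4 + (0 : ℝ) ^ 2 + 2)) = 55 / 3 * (2 * ((2 : ℝ) / 2 * (9 / 4 + (0 : ℝ) ^ 2 + 2 - 2))) := by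
  norm_num

/-- **Korn symbol, spheroidal sector**: for `L = ℓ(ℓ+1) ≥ 2` and all `τ`, the Hermitian `2 × 2` pencil satisfies
`5·|∇v|²_S(u,v) ≤ (55/3)·((div)² + 2|e|²)_S(u,v)` for all complex amplitudes `(u, v)` (real coordinates `u₁,u₂,v₁,v₂`);
the degree-zero sector `ℓ = 0` is the `u`-only corner (`kornSymbolS0_le`). [folklore] -/
theorem kornSymbolS_le (L τ u₁ u₂ v₁ v₂ : ℝ) (hL : 2 ≤ L) :
    5 * ((25 / 4 + τ ^ 2 + L + 2) * (u₁ ^ 2 + u₂ ^ 2) + L * (25 / 4 + τ ^ 2 + L) * (v₁ ^ 2 + v₂ ^ 2) +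
        2 * (-2 * L * (u₁ * v₁ + u₂ * v₂))) ≤
      55 / 3 * ((81 / 4 + τ ^ 2) * (u₁ ^ 2 + u₂ ^ 2) + L ^ 2 * (v₁ ^ 2 + v₂ ^ 2) +
            2 * (-(9 / 2) * L * (u₁ * v₁ + u₂ * v₂) - τ * L * (u₁ * v₂ - u₂ * v₁)) +
          2 * ((25 / 4 + τ ^ 2 + 2 + L / 2) * (u₁ ^ 2 + u₂ ^ 2) +
              L * ((9 / 4 + τ ^ 2) / 2 + L - 1) * (v₁ ^ 2 + v₂ ^ 2) +
            2 * (-(1 / 4) * L * (u₁ * v₁ + u₂ * v₂) - τ / 2 * L * (u₁ * v₂ - u₂ * v₁)))) := by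
  -- `(55/3)·Den − 5·Num` has entries `A = 1265/2 + 50τ² + (40/3)L`, `B = L(−245/3 + (110/3)iτ)`,
  -- `C = L(50L + (40/3)τ² − 80/3)`; `A·form = |A u + B v|² + (AC − |B|²)|v|²`.
  have hL0 : (0 : ℝ) ≤ L := by linarith
  have hA : (0 : ℝ) < 1265 / 2 + 50 * τ ^ 2 + 40 / 3 * L := by positivity
  have hdet : 0 ≤ L * (2000 / 3 * L ^ 2 + 4000 / 3 * L * τ ^ 2 + 24600 * L + 2000 / 3 * τ ^ 4 + 7100 * τ ^ 2 -
      50600 / 3) := by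
    apply mul_nonneg hL0
    nlinarith [sq_nonneg τ, sq_nonneg (τ ^ 2), mul_nonneg hL0 (sq_nonneg τ), mul_nonneg hL0 hL0]
  have key : (1265 / 2 + 50 * τ ^ 2 + 40 / 3 * L) *
      (55 / 3 * ((81 / 4 + τ ^ 2) * (u₁ ^ 2 + u₂ ^ 2) + L ^ 2 * (v₁ ^ 2 + v₂ ^ 2) +
            2 * (-(9 / 2) * L * (u₁ * v₁ + u₂ * v₂) - τ * L * (u₁ * v₂ - u₂ * v₁)) +
          2 * ((25 / 4 + τ ^ 2 + 2 + L / 2) * (u₁ ^ 2 + u₂ ^ 2) +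
              L * ((9 / 4 + τ ^ 2) / 2 + L - 1) * (v₁ ^ 2 + v₂ ^ 2) +
            2 * (-(1 / 4) * L * (u₁ * v₁ + u₂ * v₂) - τ / 2 * L * (u₁ * v₂ - u₂ * v₁)))) -
        5 * ((25 / 4 + τ ^ 2 + L + 2) * (u₁ ^ 2 + u₂ ^ 2) + L * (25 / 4 + τ ^ 2 + L) * (v₁ ^ 2 + v₂ ^ 2) +
          2 * (-2 * L * (u₁ * v₁ + u₂ * v₂)))) =
      ((1265 / 2 + 50 * τ ^ 2 + 40 / 3 * L) * u₁ + (-(245 / 3) * L) * v₁ - (110 / 3 * τ * L) * v₂) ^ 2 +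
        ((1265 / 2 + 50 * τ ^ 2 + 40 / 3 * L) * u₂ + (-(245 / 3) * L) * v₂ + (110 / 3 * τ * L) * v₁) ^ 2 +
        L * (2000 / 3 * L ^ 2 + 4000 / 3 * L * τ ^ 2 + 24600 * L + 2000 / 3 * τ ^ 4 + 7100 * τ ^ 2 - 50600 / 3) *
          (v₁ ^ 2 + v₂ ^ 2) := by
    ring
  have hrhs : 0 ≤ ((1265 / 2 + 50 * τ ^ 2 + 40 / 3 * L) * u₁ + (-(245 / 3) * L) * v₁ - (110 / 3 * τ * L) * v₂) ^ 2 +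
        ((1265 / 2 + 50 * τ ^ 2 + 40 / 3 * L) * u₂ + (-(245 / 3) * L) * v₂ + (110 / 3 * τ * L) * v₁) ^ 2 +
        L * (2000 / 3 * L ^ 2 + 4000 / 3 * L * τ ^ 2 + 24600 * L + 2000 / 3 * τ ^ 4 + 7100 * τ ^ 2 - 50600 / 3) *
          (v₁ ^ 2 + v₂ ^ 2) := by
    have := mul_nonneg hdet (add_nonneg (sq_nonneg v₁) (sq_nonneg v₂))
    nlinarith [sq_nonneg ((1265 / 2 + 50 * τ ^ 2 + 40 / 3 * L) * u₁ + (-(245 / 3) * L) * v₁ - (110 / 3 * τ * L) * v₂),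
      sq_nonneg ((1265 / 2 + 50 * τ ^ 2 + 40 / 3 * L) * u₂ + (-(245 / 3) * L) * v₂ + (110 / 3 * τ * L) * v₁)]
  rw [← key] at hrhs
  have h2 := (mul_nonneg_iff_of_pos_left hA).1 hrhs
  linarith

/-- **Korn symbol, degree zero**: `ℓ = 0` (pure radial fields `v = U(r) x̂`): `5(|s|²+2) ≤ (55/3)(|s+2|² + 2(|s|²+2))`. [folklore] -/
theorem kornSymbolS0_le (τ : ℝ) :
    5 * (25 / 4 + τ ^ 2 + 2) ≤ 55 / 3 * ((81 / 4 + τ ^ 2) + 2 * (25 / 4 + τ ^ 2 + 2)) := by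
  nlinarith [sq_nonneg τ]

/-! ## §3 The far pencil: readout `(1/24)|∇v|²` + bare `(7/4)⟪x̂,v⟫² − ¼(‖v‖² − ⟪x̂,v⟫²)` over receipts `(4/5)((div)² + 2|e|²)`

In units where `c₆ a⁴ = 1`; for the compact table's family `c₆ a₀⁴ = (29/8)·0.97129⁴ = 3.226` divide the constant `3/40` by it. -/

/-- **Far symbol, toroidal sector**: `(1/24)L(|s|²+L) − L/4 ≤ (3/40)·(4/5)·L(|s−1|²+L−2)` for every `L ≥ 0`, `τ`
(difference `(11/600)L² + (11/600)Lτ² + (11/2400)L`). [folklore] -/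
theorem farSymbolT_le (L τ : ℝ) (hL : 0 ≤ L) :
    1 / 24 * (L * (25 / 4 + τ ^ 2 + L)) - 1 / 4 * L ≤ 3 / 40 * (4 / 5 * (2 * (L / 2 * (9 / 4 + τ ^ 2 + L - 2)))) := by
  nlinarith [mul_nonneg hL (sq_nonneg τ), mul_nonneg hL hL]

/-- **Far symbol, spheroidal sector** (every `L ≥ 0`, every `τ`, all complex amplitudes): readout plus bare deficit is at most
`(3/40)·(4/5)` of the receipts symbol.  Certificate: `(3/50)·Den − Num` has `A = 289/800 + (83/600)τ² + (11/600)L`,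
`B = L(−13/60 + (3/25)iτ)`, `C = L((83/600)L + (11/600)τ² + 11/2400)` and
`(AC − |B|²)/L = (913/360000)L² + (913/180000)Lτ² + (249/80000)L + (913/360000)τ⁴ + (209/28800)τ² + 3179/1920000` — every
coefficient positive. [folklore] -/
theorem farSymbolS_le (L τ u₁ u₂ v₁ v₂ : ℝ) (hL : 0 ≤ L) :
    1 / 24 * ((25 / 4 + τ ^ 2 + L + 2) * (u₁ ^ 2 + u₂ ^ 2) + L * (25 / 4 + τ ^ 2 + L) * (v₁ ^ 2 + v₂ ^ 2) +
          2 * (-2 * L * (u₁ * v₁ + u₂ * v₂))) +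
        7 / 4 * (u₁ ^ 2 + u₂ ^ 2) - 1 / 4 * ((u₁ ^ 2 + u₂ ^ 2) + L * (v₁ ^ 2 + v₂ ^ 2)) ≤
      3 / 40 * (4 / 5 * ((81 / 4 + τ ^ 2) * (u₁ ^ 2 + u₂ ^ 2) + L ^ 2 * (v₁ ^ 2 + v₂ ^ 2) +
            2 * (-(9 / 2) * L * (u₁ * v₁ + u₂ * v₂) - τ * L * (u₁ * v₂ - u₂ * v₁)) +
          2 * ((25 / 4 + τ ^ 2 + 2 + L / 2) * (u₁ ^ 2 + u₂ ^ 2) +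
              L * ((9 / 4 + τ ^ 2) / 2 + L - 1) * (v₁ ^ 2 + v₂ ^ 2) +
            2 * (-(1 / 4) * L * (u₁ * v₁ + u₂ * v₂) - τ / 2 * L * (u₁ * v₂ - u₂ * v₁))))) := by
  have hA : (0 : ℝ) < 289 / 800 + 83 / 600 * τ ^ 2 + 11 / 600 * L := by positivity
  have hdet : 0 ≤ L * (913 / 360000 * L ^ 2 + 913 / 180000 * L * τ ^ 2 + 249 / 80000 * L + 913 / 360000 * τ ^ 4 +
      209 / 28800 * τ ^ 2 + 3179 / 1920000) := by
    apply mul_nonneg hL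
    positivity
  have key : (289 / 800 + 83 / 600 * τ ^ 2 + 11 / 600 * L) *
      (3 / 40 * (4 / 5 * ((81 / 4 + τ ^ 2) * (u₁ ^ 2 + u₂ ^ 2) + L ^ 2 * (v₁ ^ 2 + v₂ ^ 2) +
            2 * (-(9 / 2) * L * (u₁ * v₁ + u₂ * v₂) - τ * L * (u₁ * v₂ - u₂ * v₁)) +
          2 * ((25 / 4 + τ ^ 2 + 2 + L / 2) * (u₁ ^ 2 + u₂ ^ 2) +
              L * ((9 / 4 + τ ^ 2) / 2 + L - 1) * (v₁ ^ 2 + v₂ ^ 2) +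
            2 * (-(1 / 4) * L * (u₁ * v₁ + u₂ * v₂) - τ / 2 * L * (u₁ * v₂ - u₂ * v₁))))) -
        (1 / 24 * ((25 / 4 + τ ^ 2 + L + 2) * (u₁ ^ 2 + u₂ ^ 2) + L * (25 / 4 + τ ^ 2 + L) * (v₁ ^ 2 + v₂ ^ 2) +
              2 * (-2 * L * (u₁ * v₁ + u₂ * v₂))) +
            7 / 4 * (u₁ ^ 2 + u₂ ^ 2) - 1 / 4 * ((u₁ ^ 2 + u₂ ^ 2) + L * (v₁ ^ 2 + v₂ ^ 2)))) =
      ((289 / 800 + 83 / 600 * τ ^ 2 + 11 / 600 * L) * u₁ + (-(13 / 60) * L) * v₁ - (3 / 25 * τ * L) * v₂) ^ 2 +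
        ((289 / 800 + 83 / 600 * τ ^ 2 + 11 / 600 * L) * u₂ + (-(13 / 60) * L) * v₂ + (3 / 25 * τ * L) * v₁) ^ 2 +
        L * (913 / 360000 * L ^ 2 + 913 / 180000 * L * τ ^ 2 + 249 / 80000 * L + 913 / 360000 * τ ^ 4 +
            209 / 28800 * τ ^ 2 + 3179 / 1920000) * (v₁ ^ 2 + v₂ ^ 2) := by
    ring
  have hrhs : 0 ≤ ((289 / 800 + 83 / 600 * τ ^ 2 + 11 / 600 * L) * u₁ + (-(13 / 60) * L) * v₁ - (3 / 25 * τ * L) * v₂) ^ 2 +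
        ((289 / 800 + 83 / 600 * τ ^ 2 + 11 / 600 * L) * u₂ + (-(13 / 60) * L) * v₂ + (3 / 25 * τ * L) * v₁) ^ 2 +
        L * (913 / 360000 * L ^ 2 + 913 / 180000 * L * τ ^ 2 + 249 / 80000 * L + 913 / 360000 * τ ^ 4 +
            209 / 28800 * τ ^ 2 + 3179 / 1920000) * (v₁ ^ 2 + v₂ ^ 2) := by
    have := mul_nonneg hdet (add_nonneg (sq_nonneg v₁) (sq_nonneg v₂))
    positivity
  rw [← key] at hrhs
  have h2 := (mul_nonneg_iff_of_pos_left hA).1 hrhs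
  linarith

/-- **Far symbol, degree zero**: `ℓ = 0` (breathing fields): `(1/24)(|s|²+2) + 7/4 − 1/4 ≤ (3/50)(|s+2|² + 2(|s|²+2))`. [folklore] -/
theorem farSymbolS0_le (τ : ℝ) :
    1 / 24 * (25 / 4 + τ ^ 2 + 2) + 7 / 4 - 1 / 4 ≤ 3 / 40 * (4 / 5 * ((81 / 4 + τ ^ 2) + 2 * (25 / 4 + τ ^ 2 + 2))) := by
  nlinarith [sq_nonneg τ]

end Summit.AtomisticToContinuum.Crystallization.Theorems.StrictSplittingRuleBirth

end
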